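import Summits.Ventures.PercRepro.SixFourT4Bridge

/-!
# PercRepro — C-025 at `(6,4)`: the price certificate `(C_τ)` of §22.5 at `g = 7, 8, 9` (p2, gen 8 — §21.18.2 (a))

mine-2's `MINE2-RLS.md` §21.18.2 (a): the certificate `(C_τ)` of §22.5 (`SixFourT4Certificate.lean`) holds with the
SAME price formulas `y_P = F(g)/C(g,2)`, `y_m = [y_P·C(m,2) + bonus(m) + (2/3)·ε(m)·C(g − m, 2)]/(g − m)` for
`g = 7, 8, 9` on every admissible profile of a plane with `3 ≤ p ≤ g − 3` points — the only planes of a GENERIC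
solid (`j4cert_xi.py 7 9`: 4 / 10 / 24 profile vectors, 0 failures, minimum slacks `47/35`, `65/28`, `65/21`).  The
prices are literals (`yPS`, `yPriceS`; `y_P`: g = 7: 24/7, 8: 65/14, 9: 65/9), the check is a `decide` over the
integer-scaled inequality `CertNS` (denominators 105 / 420 / 630) on the bounded vectors with `p + 3 ≤ g`, and
`price_certificate_S` transfers it to `CertQS` (the rational `(C_τ)` with these prices); `certQ_of_trace_S` is the
plane-trace form (the bridge lemmas of `SixFourT4Bridge.lean` need only `p ≤ 7`).
-/

namespace PercRepro.SixFour

/-! ## The prices at `g = 7, 8, 9` (literals; `y_m·(g − m) = y_P·C(m,2) + bonus(m) + (2/3)·ε(m)·C(g − m, 2)`) -/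

/-- `y_P(g) = F(g)/C(g,2)` for `g = 7, 8, 9`. -/
def yPS : ℕ → ℚ
  | 7 => 24/7
  | 8 => 65/14
  | 9 => 65/9
  | _ => 0

/-- The prices `y_m(g)`, `g = 7, 8, 9`, `m = 2..6`. -/
def yPriceS : ℕ → ℕ → ℚ
  | 7, 2 => 24 / 35
  | 7, 3 => 25 / 7
  | 7, 4 => 76 / 7
  | 7, 5 => 2906 / 105
  | 7, 6 => 2948 / 35
  | 8, 2 => 65 / 84
  | 8, 3 => 173 / 42
  | 8, 4 => 349 / 28
  | 8, 5 => 3109 / 105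
  | 8, 6 => 9131 / 140
  | 9, 2 => 65 / 63
  | 9, 3 => 95 / 18
  | 9, 4 => 236 / 15
  | 9, 5 => 3299 / 90
  | 9, 6 => 3377 / 45
  | _, _ => 0

/-- The common denominator `D_g` of the prices and of `2/5, 8/5, 6/5, 2/3`. -/
def DgS : ℕ → ℕ
  | 7 => 105
  | 8 => 420
  | 9 => 630
  | _ => 1

/-- The integer prices `D_g · y_m(g)`. -/
def YNS : ℕ → ℕ → ℕ
  | 7, 2 => 72
  | 7, 3 => 375
  | 7, 4 => 1140
  | 7, 5 => 2906
  | 7, 6 => 8844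
  | 8, 2 => 325
  | 8, 3 => 1730
  | 8, 4 => 5235
  | 8, 5 => 12436
  | 8, 6 => 27393
  | 9, 2 => 650
  | 9, 3 => 3325
  | 9, 4 => 9912
  | 9, 5 => 23093
  | 9, 6 => 47278
  | _, _ => 0

/-- `y_m(g)·(g − m) = y_P(g)·C(m,2) + bonus(m) + (2/3)·ε(m)·C(g − m, 2)` for `7 ≤ g ≤ 9`, `2 ≤ m ≤ 6`. -/
theorem price_identity_S {g m : ℕ} (hg : 7 ≤ g) (hg' : g ≤ 9) (hm : 2 ≤ m) (hm' : m ≤ 6) :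
    yPriceS g m * ((g - m : ℕ) : ℚ) = yPS g * (m.choose 2 : ℚ) + bonus m + 2 / 3 * (eps m : ℚ) * ((g - m).choose 2 : ℚ) := by
  interval_cases g <;> interval_cases m <;> simp only [yPriceS, yPS, bonus, delta, eps, S3] <;> norm_num [Nat.choose]

/-- `F(g) = y_P(g)·C(g, 2)` for `7 ≤ g ≤ 9`. -/
theorem Fg_eq_yPS {g : ℕ} (hg : 7 ≤ g) (hg' : g ≤ 9) : Fg g = yPS g * (g.choose 2 : ℚ) := by
  interval_cases g <;> simp only [Fg, yPS, S3] <;> norm_num [Nat.choose]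

/-- The prices are nonnegative. -/
theorem yPriceS_nonneg {g : ℕ} (hg : 7 ≤ g) (hg' : g ≤ 9) (m : ℕ) : 0 ≤ yPriceS g m := by
  interval_cases g <;> (match m with
    | 2 | 3 | 4 | 5 | 6 => simp only [yPriceS]; norm_num
    | 0 | 1 | n + 7 => simp only [yPriceS]; norm_num)

/-- `y_P ≥ 0`. -/
theorem yPS_nonneg (g : ℕ) : 0 ≤ yPS g := by
  unfold yPS
  split <;> norm_num

/-! ## The certificate inequalities with these prices -/

/-- `(C_τ)` in `ℚ` with the small-`g` prices. -/
def CertQS (g p i2 i3 i4 i5 i6 : ℕ) : Prop :=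
  ((g : ℚ) - p - 2 / 5) * (D3Prof p i4 i5 i6 : ℚ) - 8 / 5 * (r34Prof p i4 i5 i6 : ℚ) +
      6 / 5 * (xiProf g p i2 i3 i4 i5 i6 : ℚ) + 2 / 3 * (lppProf p i3 i4 i5 i6 : ℚ) ≤
    yPriceS g 2 * i2 * ((p - 2 : ℕ) : ℚ) + yPriceS g 3 * i3 * ((p - 3 : ℕ) : ℚ) + yPriceS g 4 * i4 * ((p - 4 : ℕ) : ℚ) +
      yPriceS g 5 * i5 * ((p - 5 : ℕ) : ℚ) + yPriceS g 6 * i6 * ((p - 6 : ℕ) : ℚ)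

/-- `D_g · (C_τ)` as an inequality in `ℕ` (negative terms moved to the right). -/
def CertNS (g p i2 i3 i4 i5 i6 : ℕ) : Prop :=
  DgS g * (g - p) * D3Prof p i4 i5 i6 + (6 * DgS g / 5) * xiProf g p i2 i3 i4 i5 i6 + (2 * DgS g / 3) * lppProf p i3 i4 i5 i6 ≤
    YNS g 2 * i2 * (p - 2) + YNS g 3 * i3 * (p - 3) + YNS g 4 * i4 * (p - 4) + YNS g 5 * i5 * (p - 5) + YNS g 6 * i6 * (p - 6) +
      (2 * DgS g / 5) * D3Prof p i4 i5 i6 + (8 * DgS g / 5) * r34Prof p i4 i5 i6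

/-- `CertNS` is decidable. -/
instance (g p i2 i3 i4 i5 i6 : ℕ) : Decidable (CertNS g p i2 i3 i4 i5 i6) := by unfold CertNS; infer_instance

/-- The bounded search space of `certCheck`, restricted to the planes of a generic solid: `p + 3 ≤ g`. -/
def certCheckS (g : ℕ) : Prop := ∀ p < 8, ∀ i3 < 8, ∀ i4 < 4, ∀ i5 < 3, ∀ i6 < 2,
  (!decide (p + 3 ≤ g ∧ ProfileOK p (p.choose 2 - (3 * i3 + 6 * i4 + 10 * i5 + 15 * i6)) i3 i4 i5 i6) ||
    decide (CertNS g p (p.choose 2 - (3 * i3 + 6 * i4 + 10 * i5 + 15 * i6)) i3 i4 i5 i6)) = true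

/-- The finite check at `g = 7` (`4` admissible profiles with `p ≤ 4`). -/
theorem certCheckS_7 : certCheckS 7 := by
  unfold certCheckS
  decide

/-- The finite check at `g = 8` (`10` admissible profiles with `p ≤ 5`). -/
theorem certCheckS_8 : certCheckS 8 := by
  unfold certCheckS
  decide

/-- The finite check at `g = 9` (`24` admissible profiles with `p ≤ 6`). -/
theorem certCheckS_9 : certCheckS 9 := by
  unfold certCheckS
  decide

/-- `CertNS g` for every admissible profile with `p + 3 ≤ g`, `7 ≤ g ≤ 9`. -/
theorem certNS_of_profileOK {g p i2 i3 i4 i5 i6 : ℕ} (hg : 7 ≤ g) (hg' : g ≤ 9) (hp : p + 3 ≤ g) (h3 : i3 < 8)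
    (h4 : i4 < 4) (h5 : i5 < 3) (h6 : i6 < 2) (hok : ProfileOK p i2 i3 i4 i5 i6) : CertNS g p i2 i3 i4 i5 i6 := by
  have hi2 : i2 = p.choose 2 - (3 * i3 + 6 * i4 + 10 * i5 + 15 * i6) := by
    have := hok.1
    omega
  subst hi2
  have key : ∀ g, certCheckS g → p + 3 ≤ g → CertNS g p (p.choose 2 - (3 * i3 + 6 * i4 + 10 * i5 + 15 * i6)) i3 i4 i5 i6 := by
    intro g hc hpg
    have h := hc p (by omega) i3 h3 i4 h4 i5 h5 i6 h6
    rw [Bool.or_eq_true, Bool.not_eq_true', decide_eq_false_iff_not, decide_eq_true_eq] at h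
    exact h.resolve_left (not_not.2 ⟨hpg, hok⟩)
  interval_cases g
  · exact key 7 certCheckS_7 hp
  · exact key 8 certCheckS_8 hp
  · exact key 9 certCheckS_9 hp

/-- **The price certificate `(C_τ)` at `g = 7, 8, 9`** for every admissible profile with `p + 3 ≤ g`, in `ℚ`. -/
theorem price_certificate_S {g p i2 i3 i4 i5 i6 : ℕ} (hg : 7 ≤ g) (hg' : g ≤ 9) (hp : p + 3 ≤ g) (h3 : i3 < 8)
    (h4 : i4 < 4) (h5 : i5 < 3) (h6 : i6 < 2) (hok : ProfileOK p i2 i3 i4 i5 i6) : CertQS g p i2 i3 i4 i5 i6 := by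
  have hN := certNS_of_profileOK hg hg' hp h3 h4 h5 h6 hok
  have hgp : p ≤ g := by omega
  unfold CertNS at hN
  unfold CertQS
  have hcast : ((g - p : ℕ) : ℚ) = (g : ℚ) - p := Nat.cast_sub hgp
  interval_cases g <;> simp only [DgS, YNS, yPriceS] at hN ⊢ <;> norm_num at hN ⊢ <;>
    (have hN' := (Nat.cast_le (α := ℚ)).2 hN; push_cast [hcast] at hN'; linarith)

open Finset ThmH

variable {α : Type*} [DecidableEq α] {M : Matroid α} [M.Finite] {G : Finset α}

/-- **`(C_τ)` for every rank-`3` plane trace with `p + 3 ≤ g`**, `7 ≤ g ≤ 9` (`certQ_of_trace` with the small-`g`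
prices; the bridge needs only `p ≤ 7`). -/
theorem certQ_of_trace_S (hs : Simple M) (hG : G ⊆ gr M) {g : ℕ} (hg : 7 ≤ g) (hg' : g ≤ 9) {P : Finset α}
    (hp : (P ∩ G).card + 3 ≤ g) (hr : M.eRk ((P ∩ G : Finset α) : Set α) = 3) :
    CertQS g (P ∩ G).card (inc M (P ∩ G) 2) (inc M (P ∩ G) 3) (inc M (P ∩ G) 4) (inc M (P ∩ G) 5)
      (inc M (P ∩ G) 6) := by
  have hρ : P ∩ G ⊆ gr M := Finset.inter_subset_right.trans hG
  have h7 : (P ∩ G).card ≤ 7 := by omega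
  obtain ⟨h3, h4, h5, h6⟩ := inc_bounds_of_trace hs hρ h7
  exact price_certificate_S hg hg' hp h3 h4 h5 h6 (profileOK_of_trace hs hρ hr h7)

end PercRepro.SixFour
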